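import Summits.CriticalPhenomena.PercolationContinuityZ3.Theorems.PercNearOneGluingNoHeavyLowerTailThreePartitionGridMatching
import Summits.CriticalPhenomena.PercolationContinuityZ3.Theorems.PercNearOneGluingNoHeavyLowerTailThreePartitionGridNested
import Mathlib.Combinatorics.Hall.Basic
import HarnessLib.Audit

/-!
# `NoHeavyLowerTail` (crux stmt-CriticalPhenomena-4575), master-family hierarchy P3 (gen 34): Hall's theorem for the grid-transport
# kernel — `GTMatchable ⟺ ∑_{q∈𝒰} κ ≥ 0 for all up-closed 𝒰`, hence `GridTransport ⟺` "every instance has a token matching",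
# and a token matching EXISTS for every nested pair

Support file (seat `prim-masterthm-p3`; `--supports stmt-CriticalPhenomena-4575`; memo
`run/shared/lean/prim/prim-masterthm/FROM-prim-masterthm-p3-g34-FIBRE-LOCAL-CERTIFICATE.md` §5c/§8, HIERARCHY §41).  Companion of
`…ThreePartitionGridMatching` (tokens, `GTMatchable`, the easy direction `sum_gtKernel_nonneg_of_gtMatchable`) and
`…ThreePartitionGridNested` (`sum_gtKernel_nonneg_of_nested`).

THE HARD DIRECTION OF HALL (this file).  The negative tokens of `(τ,𝒱,𝒲)` are matched into the positive tokens along the grid order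
iff Hall's condition holds; for a set `s` of negative tokens the neighbourhood is the set of positive tokens in the up-closure `𝒰`
of the configurations of `s`, and `#s ≤ #(negative tokens in 𝒰) ≤ #(positive tokens in 𝒰)` is exactly `∑_{q∈𝒰} κ ≥ 0`
(`sum_gtKernel_eq_card_sub_card`).  Mathlib's `Finset.all_card_le_biUnion_card_iff_exists_injective` then produces the matching:
**`gtMatchable_of_sum_gtKernel_nonneg`**, **`gtMatchable_iff`**.  Consequences: **`gtMatchable_of_nested`** (a token matching exists
whenever `𝒱 ⊆ 𝒲` or `𝒲 ⊆ 𝒱`, from `sum_gtKernel_nonneg_of_nested`) and **`gridTransport_iff_gtMatchable`** (the conjecture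
`GridTransport` is literally the statement that every instance admits a token matching — so it may be attacked, instance by instance,
in matching form with no loss).
HONEST LABEL: Hall's marriage theorem applied to a kernel identity already in the tree; `GridTransport`, COMB-C3 and Sahi's `C₃` remain
OPEN; nothing here bears on the crux. [this work]
-/

noncomputable section

open Finset
open scoped symmDiff Classical

namespace Summit.CriticalPhenomena.PercolationContinuityZ3.Theorems.ThreePartition

variable {ι : Type*} [Fintype ι]

omit [Fintype ι] in
/-- The grid order is reflexive. [this work] -/
theorem gle_refl (τ : Set ι) (q : Set ι × Set ι) : gle τ q q := ⟨subset_rfl, subset_rfl⟩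

omit [Fintype ι] in
/-- The grid order is transitive. [this work] -/
theorem gle_trans (τ : Set ι) {q q' q'' : Set ι × Set ι} (h : gle τ q q') (h' : gle τ q' q'') : gle τ q q'' :=
  ⟨h.1.trans h'.1, h'.2.trans h.2⟩

/-- **Hall, hard direction**: if `∑_{q∈𝒰} κ_{τ,𝒱,𝒲}(q) ≥ 0` for every family `𝒰` of configurations closed upwards in the grid order,
then the negative tokens can be matched injectively to positive tokens above them (`GTMatchable`). [this work] -/
theorem gtMatchable_of_sum_gtKernel_nonneg (τ : Set ι) (𝒱 𝒲 : Set (Set ι))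
    (h : ∀ 𝒰 : Set (Set ι × Set ι),
      (∀ q q' : Set ι × Set ι, q ∈ 𝒰 → q.1 ∆ τ ⊆ q'.1 ∆ τ → q'.2 ∆ τ ⊆ q.2 ∆ τ → q' ∈ 𝒰) →
      0 ≤ ∑ q ∈ (cfgs ι).filter (fun q => q ∈ 𝒰), gtKernel τ 𝒱 𝒲 q) :
    GTMatchable τ 𝒱 𝒲 := by
  let t : negToks τ 𝒱 𝒲 → Finset ((Set ι × Set ι) × Fin 3) := fun n => (posToks τ 𝒱 𝒲).filter fun p => gle τ n.1.1 p.1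
  have hHall : ∀ s : Finset (negToks τ 𝒱 𝒲), #s ≤ #(s.biUnion t) := by
    intro s
    -- the up-closure `𝒰` of the configurations of `s` (kept opaque, so that all `filter`s use the classical instance)
    obtain ⟨𝒰, h𝒰mem⟩ : ∃ 𝒰 : Set (Set ι × Set ι), ∀ q', q' ∈ 𝒰 ↔ ∃ n ∈ s, gle τ n.1.1 q' :=
      ⟨{q' | ∃ n ∈ s, gle τ n.1.1 q'}, fun _ => Iff.rfl⟩
    have h𝒰 : ∀ q q' : Set ι × Set ι, q ∈ 𝒰 → q.1 ∆ τ ⊆ q'.1 ∆ τ → q'.2 ∆ τ ⊆ q.2 ∆ τ → q' ∈ 𝒰 := by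
      intro q q' hq h1 h2
      obtain ⟨n, hn, hq⟩ := (h𝒰mem q).1 hq
      exact (h𝒰mem q').2 ⟨n, hn, gle_trans τ hq ⟨h1, h2⟩⟩
    have hbi : s.biUnion t = (posToks τ 𝒱 𝒲).filter fun p => p.1 ∈ 𝒰 := by
      ext p
      simp only [mem_biUnion, mem_filter, t, h𝒰mem]
      constructor
      · rintro ⟨n, hn, hp, hg⟩
        exact ⟨hp, n, hn, hg⟩
      · rintro ⟨hp, n, hn, hg⟩
        exact ⟨n, hn, hp, hg⟩
    have hsN : #s ≤ #((negToks τ 𝒱 𝒲).filter fun p => p.1 ∈ 𝒰) := by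
      calc #s = #(s.map (Function.Embedding.subtype _)) := (card_map _).symm
        _ ≤ #((negToks τ 𝒱 𝒲).filter fun p => p.1 ∈ 𝒰) := by
          refine card_le_card fun p hp => ?_
          obtain ⟨n, hn, rfl⟩ := mem_map.1 hp
          exact mem_filter.2 ⟨n.2, (h𝒰mem _).2 ⟨n, hn, gle_refl τ _⟩⟩
    have hsum := h 𝒰 h𝒰
    rw [sum_gtKernel_eq_card_sub_card, sub_nonneg, Nat.cast_le] at hsum
    rw [hbi]
    exact hsN.trans hsum
  obtain ⟨f, hf, hft⟩ := (all_card_le_biUnion_card_iff_exists_injective t).1 hHall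
  refine ⟨fun p => if hp : p ∈ negToks τ 𝒱 𝒲 then f ⟨p, hp⟩ else p, fun p hp => ?_, fun p hp p' hp' hpp' => ?_⟩
  · have hp' : p ∈ negToks τ 𝒱 𝒲 := hp
    simp only [dif_pos hp']
    have hm := mem_filter.1 (hft ⟨p, hp'⟩)
    exact ⟨hm.1, hm.2⟩
  · have h1 : p ∈ negToks τ 𝒱 𝒲 := hp
    have h2 : p' ∈ negToks τ 𝒱 𝒲 := hp'
    simp only [dif_pos h1, dif_pos h2] at hpp'
    exact congrArg Subtype.val (hf hpp')

/-- **Hall for the grid-transport kernel**: a token matching exists iff the kernel sum over every up-closed family of configurations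
is nonnegative. [this work] -/
theorem gtMatchable_iff (τ : Set ι) (𝒱 𝒲 : Set (Set ι)) :
    GTMatchable τ 𝒱 𝒲 ↔
      ∀ 𝒰 : Set (Set ι × Set ι),
        (∀ q q' : Set ι × Set ι, q ∈ 𝒰 → q.1 ∆ τ ⊆ q'.1 ∆ τ → q'.2 ∆ τ ⊆ q.2 ∆ τ → q' ∈ 𝒰) →
        0 ≤ ∑ q ∈ (cfgs ι).filter (fun q => q ∈ 𝒰), gtKernel τ 𝒱 𝒲 q :=
  ⟨fun h _ h𝒰 => sum_gtKernel_nonneg_of_gtMatchable h h𝒰, gtMatchable_of_sum_gtKernel_nonneg τ 𝒱 𝒲⟩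

/-- **A token matching exists for every nested pair** (`𝒱 ⊆ 𝒲` or `𝒲 ⊆ 𝒱`): Hall applied to `sum_gtKernel_nonneg_of_nested`.
[this work] -/
theorem gtMatchable_of_nested (τ : Set ι) {𝒱 𝒲 : Set (Set ι)} (h𝒱 : IsUpperSet 𝒱) (h𝒲 : IsUpperSet 𝒲)
    (h : 𝒱 ⊆ 𝒲 ∨ 𝒲 ⊆ 𝒱) : GTMatchable τ 𝒱 𝒲 :=
  gtMatchable_of_sum_gtKernel_nonneg τ 𝒱 𝒲 fun _ h𝒰 => sum_gtKernel_nonneg_of_nested τ h𝒱 h𝒲 h h𝒰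

/-- **`GridTransport` is the statement that every instance admits a token matching.** [this work] -/
theorem gridTransport_iff_gtMatchable :
    GridTransport ↔
      ∀ (ι : Type) [Fintype ι] (τ : Set ι) (𝒱 𝒲 : Set (Set ι)), IsUpperSet 𝒱 → IsUpperSet 𝒲 → GTMatchable τ 𝒱 𝒲 := by
  constructor
  · intro h ι _ τ 𝒱 𝒲 h𝒱 h𝒲
    exact gtMatchable_of_sum_gtKernel_nonneg τ 𝒱 𝒲 fun 𝒰 h𝒰 => h ι τ 𝒱 𝒲 𝒰 h𝒱 h𝒲 h𝒰
  · exact gridTransport_of_gtMatchable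

end Summit.CriticalPhenomena.PercolationContinuityZ3.Theorems.ThreePartition

end
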